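import Mathlib
import HarnessLib
import Summits.ResolutionOfSingularities.ResolutionOfSingularities.Theorems.WildQuotientsWildQuotientResolutionS1aQhAwayDatum

/-!
# S1a — R4e preliminaries, POLYNOMIAL LEVEL: the localising polynomial `hhᵢ = ∏_{j≠i} N(x₁ + αᵢ − αⱼ)` and the local graph tail `x₂ − x₁^{m+1}·w(x₁)`

[OURS · L1 W4.5c · lead-1 g16; plan-1 RULING R-F15p ★ R4e-rational `graphTail_killsIn_two` — per critical point `αᵢ` (recentred to the origin by
✓`FreeModel.exists_graph_recentre`) the other critical points are removed by localising at `hhᵢ`; this file proves the polynomial facts about `hhᵢ` and the local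
tail that the bricks ✓`exists_pointCentre_away₀` / ✓`exists_principalCentreChart_of_graphChartAway` take as hypotheses] — NOT statements of the manuscript; counted 0;
AI-level work, weaker than expert review. Crux stmt-ResolutionOfSingularities-17941 `CyclicQuotientFourfolds`, line `s1a-logminvertex` v13 (`stub_reachLowerInFX`).

* `GraphTail.sigma_norm_X_one_add_C` — `σ N(x₁ + c) = N(x₁ + c)` for `N(y) = ∏_{l ∈ 𝔽_p} (y + l·x₀)`; `sigma_locPoly` — `σ hh = hh` for `hh = ∏_{j ∈ s} N(x₁ + C(c j))`;
* `GraphTail.eval_locPoly` — `hh(0, 0, a₂, a₃) = ∏_{j∈s} (c j)^p`; `locPoly_sub_C_mem_span` — `hh − C(∏ (c j)^p) ∈ (x₀, x₁)`;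
* `GraphTail.graphTail_mem` — `x₂ − x₁^{m+1}·w(x₁) ∈ 𝒥_{m+1}(x₀ : m+2, x₁ : 1, x₂ : m+1)`; `subst_graphTail` — `subst t = x_none^{m+1}·(x′₂ − G_q(x_none, x′₁))` with
  `G_q = X₁^{m+1}·w(X₀X₁) ∈ k[X₀, X₁]`; `eval_point_Gq` — the `k`-point value `G_q(0, 1) = w(0)`.
-/

set_option linter.dupNamespace false

noncomputable section

open MvPolynomial
open Literature.AlgebraicGeometry.Resolution
open Summit.ResolutionOfSingularities.ResolutionOfSingularities.Theorems.WildQuotientResolution.S1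
open Summit.ResolutionOfSingularities.ResolutionOfSingularities.Theorems.WildQuotientResolution.S1.KillCert

namespace Summit.ResolutionOfSingularities.ResolutionOfSingularities.Theorems.WildQuotientResolution.S1.GraphTail

variable {k : Type} [Field k] {p : ℕ}

/-! ## The norm of a translate of `x₁` and the localising polynomial -/

/-- **`σ` fixes the norm `N(x₁ + c) = ∏_{l ∈ 𝔽_p} (x₁ + c + l·x₀)`** (`σx₀ = x₀`, `σx₁ = x₁ + x₀`, `σ` fixes constants; characteristic `p`). -/
theorem sigma_norm_X_one_add_C [Fact p.Prime] [CharP k p] (σ : MvPolynomial (Fin 4) k ≃+* MvPolynomial (Fin 4) k) (hC : ∀ a : k, σ (C a) = C a)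
    (h0 : σ (X 0) = X 0) (h1 : σ (X 1) = X 1 + X 0) (c : k) :
    σ (∏ l : ZMod p, (X 1 + C c + (l.val : MvPolynomial (Fin 4) k) * X 0)) = ∏ l : ZMod p, (X 1 + C c + (l.val : MvPolynomial (Fin 4) k) * X 0) := by
  have hp1 : p ≠ 1 := (Fact.out : p.Prime).ne_one
  haveI : CharP (MvPolynomial (Fin 4) k) p := inferInstance
  exact QhAbs.qha_norm_one_fixed σ (![X 0, X 1 + C c, X 2] : Fin 3 → MvPolynomial (Fin 4) k) h0
    (show σ (X 1 + C c) = X 1 + C c + X 0 by rw [map_add, h1, hC]; ring) hp1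

/-- **`σ` fixes the localising polynomial** `hh = ∏_{j ∈ s} N(x₁ + C (c j))`. -/
theorem sigma_locPoly [Fact p.Prime] [CharP k p] (σ : MvPolynomial (Fin 4) k ≃+* MvPolynomial (Fin 4) k) (hC : ∀ a : k, σ (C a) = C a)
    (h0 : σ (X 0) = X 0) (h1 : σ (X 1) = X 1 + X 0) {ι : Type} (s : Finset ι) (c : ι → k) :
    σ (∏ j ∈ s, ∏ l : ZMod p, (X 1 + C (c j) + (l.val : MvPolynomial (Fin 4) k) * X 0)) =
      ∏ j ∈ s, ∏ l : ZMod p, (X 1 + C (c j) + (l.val : MvPolynomial (Fin 4) k) * X 0) := by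
  rw [map_prod]
  exact Finset.prod_congr rfl fun j _ => sigma_norm_X_one_add_C σ hC h0 h1 (c j)

/-- **The localising polynomial at a point of `V(x₀, x₁)`**: `hh(a) = ∏_{j∈s} (c j)^p` whenever `a₀ = a₁ = 0`. -/
theorem eval_locPoly [NeZero p] {ι : Type} (s : Finset ι) (c : ι → k) (a : Fin 4 → k) (ha0 : a 0 = 0) (ha1 : a 1 = 0) :
    MvPolynomial.eval a (∏ j ∈ s, ∏ l : ZMod p, (X 1 + C (c j) + (l.val : MvPolynomial (Fin 4) k) * X 0)) = ∏ j ∈ s, c j ^ p := by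
  rw [eval_prod]
  refine Finset.prod_congr rfl fun j _ => ?_
  rw [eval_prod]
  simp only [map_add, map_mul, map_natCast, eval_X, eval_C, ha0, ha1, zero_add, mul_zero, add_zero]
  rw [Finset.prod_const, Finset.card_univ, ZMod.card]

/-- The localising polynomial does not vanish at such a point when all `c j ≠ 0`. -/
theorem eval_locPoly_ne_zero [NeZero p] {ι : Type} (s : Finset ι) (c : ι → k) (hc : ∀ j ∈ s, c j ≠ 0) (a : Fin 4 → k) (ha0 : a 0 = 0) (ha1 : a 1 = 0) :
    MvPolynomial.eval a (∏ j ∈ s, ∏ l : ZMod p, (X 1 + C (c j) + (l.val : MvPolynomial (Fin 4) k) * X 0)) ≠ 0 := by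
  rw [eval_locPoly s c a ha0 ha1]
  exact Finset.prod_ne_zero_iff.mpr fun j hj => pow_ne_zero _ (hc j hj)

/-- **`hh ≡ C(∏ (c j)^p)` modulo `(x₀, x₁)`**, in the form used by ✓`Scheme.zeroLocus_inter_subset_basicOpen_of_sub_C_mem_span` with `v = (0, 1, 2)`. -/
theorem locPoly_sub_C_mem_span [NeZero p] {ι : Type} (s : Finset ι) (c : ι → k) :
    (∏ j ∈ s, ∏ l : ZMod p, (X 1 + C (c j) + (l.val : MvPolynomial (Fin 4) k) * X 0)) - C (∏ j ∈ s, c j ^ p) ∈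
      Ideal.span (Set.range ((X : Fin 4 → MvPolynomial (Fin 4) k) ∘ (![0, 1, 2] : Fin 3 → Fin 4))) := by
  classical
  set Q := Ideal.Quotient.mk (Ideal.span (Set.range ((X : Fin 4 → MvPolynomial (Fin 4) k) ∘ (![0, 1, 2] : Fin 3 → Fin 4)))) with hQ
  have hX0 : Q (X 0) = 0 := Ideal.Quotient.eq_zero_iff_mem.mpr (Ideal.subset_span ⟨0, rfl⟩)
  have hX1 : Q (X 1) = 0 := Ideal.Quotient.eq_zero_iff_mem.mpr (Ideal.subset_span ⟨1, rfl⟩)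
  rw [← Ideal.Quotient.eq, ← hQ, map_prod Q, map_prod C, map_prod Q]
  refine Finset.prod_congr rfl fun j _ => ?_
  rw [map_prod Q, map_pow, map_pow]
  simp only [map_add, map_mul, map_natCast, hX0, hX1, zero_add, mul_zero, add_zero]
  rw [Finset.prod_const, Finset.card_univ, ZMod.card]

/-! ## The local graph tail `t = x₂ − x₁^{m+1}·w(x₁)` -/

/-- **The local tail lies in `𝒥_{m+1}`** of the centre `(x₀ : m+2, x₁ : 1, x₂ : m+1)`. -/
theorem graphTail_mem (m : ℕ) (wl : Polynomial k) :
    (X 2 - X 1 ^ (m + 1) * Polynomial.aeval (X 1 : MvPolynomial (Fin 4) k) wl : MvPolynomial (Fin 4) k) ∈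
      (weightedFiltration (fun i => (X ((![0, 1, 2] : Fin 3 → Fin 4) i) : MvPolynomial (Fin 4) k)) ![m + 2, 1, m + 1]).ideal (m + 1) := by
  refine sub_mem (mem_weightedFiltration_ideal (fun i => (X ((![0, 1, 2] : Fin 3 → Fin 4) i) : MvPolynomial (Fin 4) k)) ![m + 2, 1, m + 1] 2)
    (Ideal.mul_mem_right _ _ ?_)
  have h := GameFrame.GModel.pow_mem_weightedFiltration_ideal (fun i => (X ((![0, 1, 2] : Fin 3 → Fin 4) i) : MvPolynomial (Fin 4) k)) ![m + 2, 1, m + 1] 1 (m + 1)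
  rwa [show (m + 1) * (![m + 2, 1, m + 1] : Fin 3 → ℕ) 1 = m + 1 from Nat.mul_one (m + 1)] at h

/-- **The local tail in the free root model**: `subst t = x_none^{m+1} · (x′₂ − G_q(x_none, x′₁))`, `G_q = X₁^{m+1}·w(X₀X₁)`. -/
theorem subst_graphTail (m : ℕ) (wl : Polynomial k) :
    cobordantAlgebra.subst k (![m + 2, 1, m + 1, 0] : Fin 4 → ℕ) (X 2 - X 1 ^ (m + 1) * Polynomial.aeval (X 1 : MvPolynomial (Fin 4) k) wl : MvPolynomial (Fin 4) k) =
      X none ^ (m + 1) * (X (some 2) - rename (![none, some 1] : Fin 2 → Option (Fin 4))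
        (X 1 ^ (m + 1) * Polynomial.aeval (X 0 * X 1 : MvPolynomial (Fin 2) k) wl : MvPolynomial (Fin 2) k)) := by
  have h1 : (![m + 2, 1, m + 1, 0] : Fin 4 → ℕ) 1 = 1 := rfl
  have h2 : (![m + 2, 1, m + 1, 0] : Fin 4 → ℕ) 2 = m + 1 := rfl
  have hs : cobordantAlgebra.subst k (![m + 2, 1, m + 1, 0] : Fin 4 → ℕ) (Polynomial.aeval (X 1 : MvPolynomial (Fin 4) k) wl) =
      Polynomial.aeval (X none * X (some 1) : MvPolynomial (Option (Fin 4)) k) wl := by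
    rw [show cobordantAlgebra.subst k (![m + 2, 1, m + 1, 0] : Fin 4 → ℕ) (Polynomial.aeval (X 1 : MvPolynomial (Fin 4) k) wl) =
        (Polynomial.aeval (X 1 : MvPolynomial (Fin 4) k) wl).eval₂ C (fun i => X none ^ (![m + 2, 1, m + 1, 0] : Fin 4 → ℕ) i * X (some i)) from rfl,
      ← MvPolynomial.coe_eval₂Hom, show (MvPolynomial.eval₂Hom C (fun i : Fin 4 => X none ^ (![m + 2, 1, m + 1, 0] : Fin 4 → ℕ) i * X (some i)) :
        MvPolynomial (Fin 4) k →+* MvPolynomial (Option (Fin 4)) k) = (MvPolynomial.aeval (fun i : Fin 4 => X none ^ (![m + 2, 1, m + 1, 0] : Fin 4 → ℕ) i * X (some i)) :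
        MvPolynomial (Fin 4) k →ₐ[k] MvPolynomial (Option (Fin 4)) k).toRingHom from rfl, AlgHom.toRingHom_eq_coe, AlgHom.coe_toRingHom,
      ← Polynomial.aeval_algHom_apply, MvPolynomial.aeval_X, h1, pow_one]
  have hr : rename (![none, some 1] : Fin 2 → Option (Fin 4)) (X 1 ^ (m + 1) * Polynomial.aeval (X 0 * X 1 : MvPolynomial (Fin 2) k) wl : MvPolynomial (Fin 2) k) =
      X (some 1) ^ (m + 1) * Polynomial.aeval (X none * X (some 1) : MvPolynomial (Option (Fin 4)) k) wl := by
    rw [map_mul, map_pow, rename_X, ← Polynomial.aeval_algHom_apply, map_mul, rename_X, rename_X]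
    rfl
  rw [map_sub, map_mul, map_pow, hs, hr, cobordantAlgebra.subst, MvPolynomial.eval₂Hom_X', MvPolynomial.eval₂Hom_X', h1, h2, pow_one]
  ring

/-- The value of `G_q` at the `k`-point `(X₀, X₁) = (0, 1)` is `w(0)`. -/
theorem eval_point_Gq (m : ℕ) (wl : Polynomial k) :
    MvPolynomial.eval (![0, 1] : Fin 2 → k) (X 1 ^ (m + 1) * Polynomial.aeval (X 0 * X 1 : MvPolynomial (Fin 2) k) wl : MvPolynomial (Fin 2) k) = wl.eval 0 := by
  have h : MvPolynomial.eval (![0, 1] : Fin 2 → k) (Polynomial.aeval (X 0 * X 1 : MvPolynomial (Fin 2) k) wl) = wl.eval 0 := by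
    have hcomp : (MvPolynomial.eval (![0, 1] : Fin 2 → k)).comp (algebraMap k (MvPolynomial (Fin 2) k)) = RingHom.id k :=
      RingHom.ext fun a => by rw [RingHom.comp_apply, MvPolynomial.algebraMap_eq, eval_C, RingHom.id_apply]
    rw [Polynomial.aeval_def, Polynomial.hom_eval₂, map_mul, eval_X, eval_X, hcomp]
    change Polynomial.eval₂ (RingHom.id k) ((0 : k) * 1) wl = _
    rw [zero_mul]
    rfl
  rw [map_mul, map_pow, eval_X, h]
  change (1 : k) ^ (m + 1) * wl.eval 0 = wl.eval 0
  rw [one_pow, one_mul]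

end Summit.ResolutionOfSingularities.ResolutionOfSingularities.Theorems.WildQuotientResolution.S1.GraphTail

end
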